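import Literature.Geometry.Lorentzian.KerrRedShiftHorizon
import HarnessLib

/-!
# The red-shift multiplier is coercive on a collar of the Kerr horizon
# (Dafermos–Rodnianski–Shlapentokh-Rothman, Prop. 4.5.1, first two bullets, qualitative form)

(family `gr`; namespaces `Literature.Geometry.Lorentzian.KerrSchild` (the bulk as a quadratic form of
the covector) and `Literature.Geometry.Lorentzian.Kerr` (the estimates); written from the proving seat
of the named fact
`Literature.Geometry.Lorentzian.DafermosRodnianskiShlapentokhRothman2016_energyBoundedness_horizonRegular`
(`KerrHorizonRegularWaveBoundedness.lean`, DRSR arXiv:1402.7034 Thm. 3.1 (23) in the §3.3 form), as the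
first ingredient of its §13.2 ("boundedness of the energy near the horizon is a trivial consequence of
the red-shift estimate, Prop. 4.5.2"): the pointwise red-shift, Prop. 4.5.1. No named fact is
introduced (D-0026); everything is proved.)

Dafermos–Rodnianski–Shlapentokh-Rothman (arXiv:1402.7034 = Ann. of Math. 183 (2016), §4.5,
Prop. 4.5.1, recalled from [dr7] and from Dafermos–Rodnianski, *Lectures on black holes and linear
waves*, arXiv:0811.0354, §3.3.2 and Thm. 7.1): *for `|a| ≤ a₀ < M` there are positive constants
`b, B`, parameters `r₁ > r_red > r₊` and a `φ_τ`-invariant timelike vector field `N` on `𝓡` such that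
`K^N ≥ b J^N_μ N^μ` for `r ≤ r_red` and `−K^N ≤ B J^N_μ N^μ` for `r ≥ r_red`* (and `N = T` for
`r ≥ r₁`). The printed proof (arXiv:0811.0354, proof of Thm. 7.1 and §3.3.2): on the horizon the bulk
of `N` is a positive-definite quadratic form in `dψ` once the parameter `σ` is large ("from `κ > 0`"),
and *"by continuity"* it stays positive on a neighbourhood `r ≤ r_red` of `𝓗⁺`, the neighbourhood
being uniform by the `φ_τ`-invariance and the compactness of the horizon spheres; the second bullet is
the boundedness of the (continuous, `φ_τ`-invariant) coefficients of `K^N` on compact `r`-ranges.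

`KerrRedShiftBulk.lean` computes `K^N` exactly for the explicit transcription
`N = (1 + h₁(r − r₊))K + (1 + f₁(r − r₊))k` (`Kerr.redShiftVector`), and `KerrRedShiftHorizon.lean`
proves the horizon positivity with explicit thresholds (`Kerr.redShift_horizon_coercive`:
`K^N ≥ ½h₁ λ² + ¼f₁ |q̸|² + ((r₊ − M)/(2Σ)) v²` on `{r = r₊}` when `(r₊ − M)h₁, (r₊ − M)f₁ ≥ 16`). This
file carries out the continuity/compactness step, i.e. proves the first two bullets of Prop. 4.5.1 for
this `N`, in the coordinate energy density `∑_μ (∂_μψ)²` of the Kerr–Schild chart: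

* `KerrSchild.bulkForm G X x p` — the bulk `K^X(x)` as a function of the covector `p = dψ(x)`
  (`KerrSchild.multiplierBulk` evaluated on the linear function `E4.covector p`), with
  `KerrSchild.multiplierBulk_eq_bulkForm` (`K^X[ψ](x) = bulkForm G X x (dψ(x))`),
  `KerrSchild.bulkForm_smul` (homogeneity of degree two) and `KerrSchild.bulkForm_add_of_invariant`
  (invariance under a translation leaving `G` and `X` invariant);
* `Kerr.continuousOn_bulkForm_redShiftVector` — joint continuity of `(x, p) ↦ K^N(x)(p)` on `{r > 0}`;
* `Kerr.bulkForm_redShiftVector_pos_of_radius_eq_rPlus` — on `𝓗⁺` the horizon form is positive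
  DEFINITE: `K^N(x)(p) > 0` for `p ≠ 0` (if `λ = v = 0` and `q̸ = 0` then `p` is a multiple of the
  null covector `ℓ`, and `ℓ(K) = 1/(2H) ≠ 0` on the horizon because `dr♯ = 2HK` and `ℓ♯(r) = 1`);
* `Kerr.exists_redShift_bulk_coercive` (**Prop. 4.5.1, first bullet, for `|a| < M`**): if
  `(r₊ − M)h₁ ≥ 16` and `(r₊ − M)f₁ ≥ 16` there are `η > 0` and `b > 0` such that
  `b ∑_μ (∂_μψ)²(x) ≤ K^N[ψ](x)` at every point with `|r(x) − r₊| ≤ η` (a two-sided collar of the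
  horizon: the red-shift also acts slightly inside the black hole, which is what a smeared inner
  boundary uses, cf. `KerrSchildCutoffCurrent.lean`), for every `ψ : E4 → ℝ`;
* `Kerr.exists_redShift_bulk_coercive_exterior` — the same on the one-sided collar
  `{r₊ ≤ r ≤ r_red}`, `r_red > r₊`, as printed;
* `Kerr.exists_abs_bulk_redShiftVector_le` (**second bullet, in the form used**): for
  `0 < r₀` and any `R` there is `B` with `|K^N[ψ](x)| ≤ B ∑_μ (∂_μψ)²(x)` whenever `r₀ ≤ r(x) ≤ R`
  (any parameters `h₁, f₁`);
* plumbing: `Kerr.two_mul_scalarH_mul_hawkingComp_nullCovectorFun` (`2H·ℓ(K) = 1` on `𝓗⁺`),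
  `Kerr.spatial_eq_of_frameAngSq_eq_zero`, `Kerr.isCompact_timeZero_radius_slab` (the slabs
  `{x⁰ = 0, |r − r₁| ≤ η₀}` are compact), `Kerr.spatialNorm_sq_le` (`‖x⃗‖² ≤ r² + a²`),
  `Kerr.radius_smul_basisVector_three` (the pole point `c∂₃` has `r = c`).

The constants are not explicit (compactness), exactly as in the printed proof ("by continuity"); the
coordinate energy density `∑_μ (∂_μψ)²` is comparable to `J^N_μ N^μ` and to `J^N_μ n^μ` for every
timelike `N` and spacelike leaf on compact `r`-ranges, so these are the printed bullets up to the
values of `b`, `B`.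

## References

* M. Dafermos, I. Rodnianski, Y. Shlapentokh-Rothman, *Decay for solutions of the wave equation on
  Kerr exterior spacetimes III: the full subextremal case `|a| < M`*, Ann. of Math. 183 (2016),
  arXiv:1402.7034: §4.5, Prop. 4.5.1 (the red-shift vector field), §13.2 (its use for boundedness)
  (key `DafermosRodnianskiShlapentokhrothman2014`).
* M. Dafermos, I. Rodnianski, *Lectures on black holes and linear waves*, Clay Math. Proc. 17,
  arXiv:0811.0354: §3.3.2 (the explicit `N` on Schwarzschild, "by continuity … for `r` close to
  `2M`"), §7, Thm. 7.1 and its proof (general sub-extremal Killing horizons; compactness of the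
  horizon sections and invariance under the Killing flow) (key `DafermosRodnianski2008`).
-/

noncomputable section

open Set Filter Metric
open scoped Topology

namespace Literature.Geometry.Lorentzian

/-! ## Part 0. The bulk term as a quadratic form of the covector -/

namespace KerrSchild

/-- The differential of the linear function `y ↦ ∑_μ p_μ y^μ` has components `p`. [folklore] -/
theorem fderiv_covector_apply (p : Fin 4 → ℝ) (x : E4) (ν : Fin 4) :
    fderiv ℝ (E4.covector p) x (E4.basisVector ν) = p ν := by
  rw [ContinuousLinearMap.fderiv, E4.covector_apply]
  have h : ∀ μ : Fin 4, p μ * (E4.basisVector ν) μ = if μ = ν then p ν else 0 := by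
    intro μ
    by_cases hμ : μ = ν
    · subst hμ; simp [E4.basisVector]
    · simp [E4.basisVector, hμ]
  simp only [h, Finset.sum_ite_eq', Finset.mem_univ, if_true]

/-- **`K^X[w](x)` depends on `w` only through `dw(x)`.** [folklore] -/
theorem multiplierBulk_congr_fderiv (G : E4 → Fin 4 → Fin 4 → ℝ) (X : E4 → Fin 4 → ℝ)
    {w w' : E4 → ℝ} {x : E4}
    (h : ∀ μ, fderiv ℝ w x (E4.basisVector μ) = fderiv ℝ w' x (E4.basisVector μ)) :
    multiplierBulk G X w x = multiplierBulk G X w' x := by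
  simp only [multiplierBulk, h]

/-- **The bulk `K^X(x)` as a quadratic form of the covector `p`**: `K^X` of the linear function
`y ↦ ∑_μ p_μ y^μ`, whose differential is `p` at every point. For `p = dψ(x)` this is `K^X[ψ](x)`
(`multiplierBulk_eq_bulkForm`). (Dafermos–Rodnianski arXiv:0811.0354, App. D: `K^V = T_{μν}[ψ]∇^μV^ν`
is a quadratic form in `dψ` with coefficients depending on the point.) [cite: DafermosRodnianski2008, App. D] -/
def bulkForm (G : E4 → Fin 4 → Fin 4 → ℝ) (X : E4 → Fin 4 → ℝ) (x : E4) (p : Fin 4 → ℝ) : ℝ :=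
  multiplierBulk G X (E4.covector p) x

/-- `K^X[w](x) = bulkForm G X x (dw(x))`. [folklore] -/
theorem multiplierBulk_eq_bulkForm (G : E4 → Fin 4 → Fin 4 → ℝ) (X : E4 → Fin 4 → ℝ)
    (w : E4 → ℝ) (x : E4) :
    multiplierBulk G X w x = bulkForm G X x (fun μ ↦ fderiv ℝ w x (E4.basisVector μ)) :=
  multiplierBulk_congr_fderiv G X fun μ ↦
    (fderiv_covector_apply (fun ν ↦ fderiv ℝ w x (E4.basisVector ν)) x μ).symm

/-- The explicit formula: `bulkForm G X x p =
∑_μ A^μ ∑_β (∂_μX^β) p_β − ½ (div X) Q − ½ ∑_μ X^μ ∑_{αβ} (∂_μG^{αβ}) p_α p_β`,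
`A^μ = ∑_ν G^{μν} p_ν`, `Q = ∑ G^{αβ} p_α p_β`. [cite: DafermosRodnianski2008, App. D] -/
theorem bulkForm_eq (G : E4 → Fin 4 → Fin 4 → ℝ) (X : E4 → Fin 4 → ℝ) (x : E4) (p : Fin 4 → ℝ) :
    bulkForm G X x p =
      (∑ μ, (∑ ν, G x μ ν * p ν) *
          ∑ β, fderiv ℝ (fun y ↦ X y β) x (E4.basisVector μ) * p β) -
        2⁻¹ * (∑ μ, fderiv ℝ (fun y ↦ X y μ) x (E4.basisVector μ)) *
          (∑ α, ∑ β, G x α β * p α * p β) -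
        2⁻¹ * ∑ μ, X x μ * ∑ α, ∑ β, fderiv ℝ (fun y ↦ G y α β) x (E4.basisVector μ) *
          p α * p β := by
  simp only [bulkForm, multiplierBulk, fderiv_covector_apply]

/-- `∑_i f_i (c g_i) = c ∑_i f_i g_i`. [folklore] -/
private theorem sum_mul_const_mul {ι : Type*} (s : Finset ι) (f g : ι → ℝ) (c : ℝ) :
    ∑ i ∈ s, f i * (c * g i) = c * ∑ i ∈ s, f i * g i := by
  rw [Finset.mul_sum]
  exact Finset.sum_congr rfl fun i _ ↦ by ring

/-- `∑_i ∑_j f_{ij} (c g_i) (c h_j) = c² ∑_i ∑_j f_{ij} g_i h_j`. [folklore] -/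
private theorem sum_sum_mul_const_mul {ι : Type*} (s : Finset ι) (f : ι → ι → ℝ) (g h : ι → ℝ)
    (c : ℝ) :
    ∑ i ∈ s, ∑ j ∈ s, f i j * (c * g i) * (c * h j) =
      c ^ 2 * ∑ i ∈ s, ∑ j ∈ s, f i j * g i * h j := by
  rw [Finset.mul_sum]
  refine Finset.sum_congr rfl fun i _ ↦ ?_
  rw [Finset.mul_sum]
  exact Finset.sum_congr rfl fun j _ ↦ by ring

/-- **Homogeneity**: `bulkForm G X x (c • p) = c² · bulkForm G X x p` (the bulk is a quadratic
form of the covector). [cite: DafermosRodnianski2008, App. D] -/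
theorem bulkForm_smul (G : E4 → Fin 4 → Fin 4 → ℝ) (X : E4 → Fin 4 → ℝ) (x : E4) (c : ℝ)
    (p : Fin 4 → ℝ) : bulkForm G X x (c • p) = c ^ 2 * bulkForm G X x p := by
  rw [bulkForm_eq, bulkForm_eq]
  simp only [Pi.smul_apply, smul_eq_mul]
  have hA : ∀ μ, ∑ ν, G x μ ν * (c * p ν) = c * ∑ ν, G x μ ν * p ν :=
    fun μ ↦ sum_mul_const_mul _ _ _ c
  have hB : ∀ μ, ∑ β, fderiv ℝ (fun y ↦ X y β) x (E4.basisVector μ) * (c * p β) =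
      c * ∑ β, fderiv ℝ (fun y ↦ X y β) x (E4.basisVector μ) * p β :=
    fun μ ↦ sum_mul_const_mul _ _ _ c
  have hQ : ∑ α, ∑ β, G x α β * (c * p α) * (c * p β) =
      c ^ 2 * ∑ α, ∑ β, G x α β * p α * p β :=
    sum_sum_mul_const_mul _ _ _ _ c
  have hR : ∀ μ, ∑ α, ∑ β, fderiv ℝ (fun y ↦ G y α β) x (E4.basisVector μ) * (c * p α) *
      (c * p β) = c ^ 2 * ∑ α, ∑ β, fderiv ℝ (fun y ↦ G y α β) x (E4.basisVector μ) *
        p α * p β :=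
    fun μ ↦ sum_sum_mul_const_mul _ _ _ _ c
  rw [hQ]
  simp only [hA, hB, hR]
  have h1 : ∑ μ, c * (∑ ν, G x μ ν * p ν) *
      (c * ∑ β, fderiv ℝ (fun y ↦ X y β) x (E4.basisVector μ) * p β) =
      c ^ 2 * ∑ μ, (∑ ν, G x μ ν * p ν) *
        ∑ β, fderiv ℝ (fun y ↦ X y β) x (E4.basisVector μ) * p β := by
    rw [Finset.mul_sum]
    exact Finset.sum_congr rfl fun μ _ ↦ by ring
  have h2 : ∑ μ, X x μ * (c ^ 2 * ∑ α, ∑ β,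
      fderiv ℝ (fun y ↦ G y α β) x (E4.basisVector μ) * p α * p β) =
      c ^ 2 * ∑ μ, X x μ * ∑ α, ∑ β,
        fderiv ℝ (fun y ↦ G y α β) x (E4.basisVector μ) * p α * p β := by
    rw [Finset.mul_sum]
    exact Finset.sum_congr rfl fun μ _ ↦ by ring
  rw [h1, h2]
  ring

/-- `bulkForm G X x 0 = 0`. [folklore] -/
theorem bulkForm_zero (G : E4 → Fin 4 → Fin 4 → ℝ) (X : E4 → Fin 4 → ℝ) (x : E4) :
    bulkForm G X x 0 = 0 := by
  have h := bulkForm_smul G X x 0 0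
  rw [zero_smul] at h
  simpa using h

/-- **Invariance**: if the coefficient field `G` and the multiplier `X` are invariant under the
translation by `v`, so is the bulk form: `bulkForm G X (x + v) p = bulkForm G X x p` (on Kerr:
stationarity, `v = t ∂_{t*}`). [folklore] -/
theorem bulkForm_add_of_invariant (G : E4 → Fin 4 → Fin 4 → ℝ) (X : E4 → Fin 4 → ℝ) {v : E4}
    (hG : ∀ y, G (y + v) = G y) (hX : ∀ y, X (y + v) = X y) (x : E4) (p : Fin 4 → ℝ) :
    bulkForm G X (x + v) p = bulkForm G X x p := by
  rw [bulkForm_eq, bulkForm_eq]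
  have hX' : ∀ β μ, fderiv ℝ (fun y ↦ X y β) (x + v) (E4.basisVector μ) =
      fderiv ℝ (fun y ↦ X y β) x (E4.basisVector μ) := by
    intro β μ
    set g : E4 → ℝ := fun y ↦ X y β with hg
    rw [← fderiv_comp_add_right]
    simp only [hg, hX]
  have hG' : ∀ α β μ, fderiv ℝ (fun y ↦ G y α β) (x + v) (E4.basisVector μ) =
      fderiv ℝ (fun y ↦ G y α β) x (E4.basisVector μ) := by
    intro α β μ
    set g : E4 → ℝ := fun y ↦ G y α β with hg
    rw [← fderiv_comp_add_right]
    simp only [hg, hG]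
  simp only [hX', hG', hG, hX]

end KerrSchild

namespace Kerr

variable {M a : ℝ} {x : E4}

/-! ## Part 1. Regularity and stationarity of the red-shift multiplier; continuity of its bulk form -/

/-- The components of the Hawking vector `K = ∂₀ + ω₊(x₁∂₂ − x₂∂₁)` are affine functions of the
point, hence `C^n`. [folklore] -/
theorem contDiff_hawkingVector_apply (M a : ℝ) (β : Fin 4) {n : WithTop ℕ∞} :
    ContDiff ℝ n fun y : E4 ↦ hawkingVector M a y β := by
  have h : (fun y : E4 ↦ hawkingVector M a y β) = fun y ↦
      E4.basisVector 0 β + horizonAngularVelocity M a *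
        ((E4.dx 1) y * E4.basisVector 2 β - (E4.dx 2) y * E4.basisVector 1 β) := by
    funext y
    rw [hawkingVector_apply]
    simp only [axialVector, PiLp.sub_apply, PiLp.smul_apply, smul_eq_mul]
    rfl
  rw [h]
  exact contDiff_const.add (contDiff_const.mul
    (((E4.dx 1).contDiff.mul contDiff_const).sub ((E4.dx 2).contDiff.mul contDiff_const)))

/-- The components of the red-shift multiplier `N` are `C^n` wherever `r > 0`. [folklore] -/
theorem contDiffAt_redShiftVector_apply (M a h₁ f₁ : ℝ) (hx : 0 < radius a x) (β : Fin 4)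
    {n : WithTop ℕ∞} : ContDiffAt ℝ n (fun y ↦ redShiftVector M a h₁ f₁ y β) x := by
  unfold redShiftVector
  have hr : ContDiffAt ℝ n (fun y ↦ radius a y - rPlus M a) x :=
    (contDiffAt_radius hx).sub contDiffAt_const
  exact ((contDiffAt_const.add (contDiffAt_const.mul hr)).mul
    (contDiff_hawkingVector_apply M a β).contDiffAt).add
    ((contDiffAt_const.add (contDiffAt_const.mul hr)).neg.mul (contDiffAt_nullVector_apply a hx β))

/-- The Hawking vector is invariant under `t*`-translations (its components depend on `x₁, x₂`
only). [folklore] -/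
theorem hawkingVector_add_smul_basisVector_zero (M a : ℝ) (x : E4) (t : ℝ) :
    hawkingVector M a (x + t • E4.basisVector 0) = hawkingVector M a x := by
  have h1 : (x + t • E4.basisVector 0) 1 = x 1 := by simp [E4.basisVector]
  have h2 : (x + t • E4.basisVector 0) 2 = x 2 := by simp [E4.basisVector]
  simp only [hawkingVector, axialVector, h1, h2]

/-- **Stationarity of `N`**: `N(x + t ∂_{t*}) = N(x)` (`φ_τ`-invariance, DRSR Prop. 4.5.1).
[cite: DafermosRodnianskiShlapentokhrothman2014, Prop. 4.5.1] -/
theorem redShiftVector_add_smul_basisVector_zero (M a h₁ f₁ : ℝ) (x : E4) (t : ℝ) :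
    redShiftVector M a h₁ f₁ (x + t • E4.basisVector 0) = redShiftVector M a h₁ f₁ x := by
  funext μ
  simp only [redShiftVector, radius_add_time_smul_basisVector,
    hawkingVector_add_smul_basisVector_zero, nullVector_add_smul_basisVector_zero]

/-- **Stationarity of the bulk form of `N`**: `K^N(x + t∂_{t*})(p) = K^N(x)(p)`.
[cite: DafermosRodnianskiShlapentokhrothman2014, Prop. 4.5.1] -/
theorem bulkForm_redShiftVector_add_smul_basisVector_zero (M a h₁ f₁ : ℝ) (x : E4) (t : ℝ)
    (p : Fin 4 → ℝ) :
    KerrSchild.bulkForm (inverseMetric M a) (redShiftVector M a h₁ f₁) (x + t • E4.basisVector 0) p =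
      KerrSchild.bulkForm (inverseMetric M a) (redShiftVector M a h₁ f₁) x p :=
  KerrSchild.bulkForm_add_of_invariant _ _
    (fun y ↦ funext fun μ ↦ funext fun ν ↦ inverseMetric_add_smul_basisVector_zero M a y t μ ν)
    (fun y ↦ redShiftVector_add_smul_basisVector_zero M a h₁ f₁ y t) x p

/-- **Joint continuity of `(x, p) ↦ K^N(x)(p)`** on `{r > 0} × ℝ⁴`: the coefficients
`g^{μν}`, `∂g^{μν}`, `N^μ`, `∂N^μ` are continuous where `r > 0` and `p` enters polynomially.
[folklore] -/
theorem continuousOn_bulkForm_redShiftVector (M a h₁ f₁ : ℝ) :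
    ContinuousOn (fun q : E4 × (Fin 4 → ℝ) ↦
      KerrSchild.bulkForm (inverseMetric M a) (redShiftVector M a h₁ f₁) q.1 q.2)
      {q | 0 < radius a q.1} := by
  set U : Set (E4 × (Fin 4 → ℝ)) := {q | 0 < radius a q.1} with hU
  -- the coefficient functions, as functions of `q`
  have hG : ∀ μ ν, ContinuousOn (fun q : E4 × (Fin 4 → ℝ) ↦ inverseMetric M a q.1 μ ν) U :=
    fun μ ν q hq ↦ ((contDiffAt_inverseMetric M a hq μ ν (n := 1)).continuousAt.comp
      continuousAt_fst).continuousWithinAt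
  have hDG : ∀ α β μ, ContinuousOn (fun q : E4 × (Fin 4 → ℝ) ↦
      fderiv ℝ (fun y ↦ inverseMetric M a y α β) q.1 (E4.basisVector μ)) U := by
    intro α β μ q hq
    have h1 : ContinuousAt (fderiv ℝ (fun y ↦ inverseMetric M a y α β)) q.1 :=
      (contDiffAt_inverseMetric M a hq α β (n := 1)).continuousAt_fderiv one_ne_zero
    exact ((h1.comp continuousAt_fst).clm_apply continuousAt_const).continuousWithinAt
  have hX : ∀ μ, ContinuousOn (fun q : E4 × (Fin 4 → ℝ) ↦ redShiftVector M a h₁ f₁ q.1 μ) U :=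
    fun μ q hq ↦ ((contDiffAt_redShiftVector_apply M a h₁ f₁ hq μ (n := 1)).continuousAt.comp
      continuousAt_fst).continuousWithinAt
  have hDX : ∀ β μ, ContinuousOn (fun q : E4 × (Fin 4 → ℝ) ↦
      fderiv ℝ (fun y ↦ redShiftVector M a h₁ f₁ y β) q.1 (E4.basisVector μ)) U := by
    intro β μ q hq
    have h1 : ContinuousAt (fderiv ℝ (fun y ↦ redShiftVector M a h₁ f₁ y β)) q.1 :=
      (contDiffAt_redShiftVector_apply M a h₁ f₁ hq β (n := 1)).continuousAt_fderiv one_ne_zero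
    exact ((h1.comp continuousAt_fst).clm_apply continuousAt_const).continuousWithinAt
  have hp : ∀ μ, ContinuousOn (fun q : E4 × (Fin 4 → ℝ) ↦ q.2 μ) U :=
    fun μ ↦ ((continuous_apply μ).comp continuous_snd).continuousOn
  -- assemble
  have hA : ∀ μ, ContinuousOn (fun q : E4 × (Fin 4 → ℝ) ↦
      ∑ ν, inverseMetric M a q.1 μ ν * q.2 ν) U :=
    fun μ ↦ continuousOn_finsetSum _ fun ν _ ↦ (hG μ ν).mul (hp ν)
  have hB : ∀ μ, ContinuousOn (fun q : E4 × (Fin 4 → ℝ) ↦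
      ∑ β, fderiv ℝ (fun y ↦ redShiftVector M a h₁ f₁ y β) q.1 (E4.basisVector μ) * q.2 β) U :=
    fun μ ↦ continuousOn_finsetSum _ fun β _ ↦ (hDX β μ).mul (hp β)
  have hQ : ContinuousOn (fun q : E4 × (Fin 4 → ℝ) ↦
      ∑ α, ∑ β, inverseMetric M a q.1 α β * q.2 α * q.2 β) U :=
    continuousOn_finsetSum _ fun α _ ↦ continuousOn_finsetSum _ fun β _ ↦
      ((hG α β).mul (hp α)).mul (hp β)
  have hR : ∀ μ, ContinuousOn (fun q : E4 × (Fin 4 → ℝ) ↦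
      ∑ α, ∑ β, fderiv ℝ (fun y ↦ inverseMetric M a y α β) q.1 (E4.basisVector μ) *
        q.2 α * q.2 β) U :=
    fun μ ↦ continuousOn_finsetSum _ fun α _ ↦ continuousOn_finsetSum _ fun β _ ↦
      ((hDG α β μ).mul (hp α)).mul (hp β)
  have hdiv : ContinuousOn (fun q : E4 × (Fin 4 → ℝ) ↦
      ∑ μ, fderiv ℝ (fun y ↦ redShiftVector M a h₁ f₁ y μ) q.1 (E4.basisVector μ)) U :=
    continuousOn_finsetSum _ fun μ _ ↦ hDX μ μ
  have h1 : ContinuousOn (fun q : E4 × (Fin 4 → ℝ) ↦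
      ∑ μ, (∑ ν, inverseMetric M a q.1 μ ν * q.2 ν) *
        ∑ β, fderiv ℝ (fun y ↦ redShiftVector M a h₁ f₁ y β) q.1 (E4.basisVector μ) * q.2 β) U :=
    continuousOn_finsetSum _ fun μ _ ↦ (hA μ).mul (hB μ)
  have h3 : ContinuousOn (fun q : E4 × (Fin 4 → ℝ) ↦
      ∑ μ, redShiftVector M a h₁ f₁ q.1 μ * ∑ α, ∑ β,
        fderiv ℝ (fun y ↦ inverseMetric M a y α β) q.1 (E4.basisVector μ) * q.2 α * q.2 β) U :=
    continuousOn_finsetSum _ fun μ _ ↦ (hX μ).mul (hR μ)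
  have h : ContinuousOn (fun q : E4 × (Fin 4 → ℝ) ↦
      (∑ μ, (∑ ν, inverseMetric M a q.1 μ ν * q.2 ν) *
          ∑ β, fderiv ℝ (fun y ↦ redShiftVector M a h₁ f₁ y β) q.1 (E4.basisVector μ) * q.2 β) -
        2⁻¹ * (∑ μ, fderiv ℝ (fun y ↦ redShiftVector M a h₁ f₁ y μ) q.1 (E4.basisVector μ)) *
          (∑ α, ∑ β, inverseMetric M a q.1 α β * q.2 α * q.2 β) -
        2⁻¹ * ∑ μ, redShiftVector M a h₁ f₁ q.1 μ * ∑ α, ∑ β,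
          fderiv ℝ (fun y ↦ inverseMetric M a y α β) q.1 (E4.basisVector μ) * q.2 α * q.2 β) U :=
    (h1.sub ((continuousOn_const.mul hdiv).mul hQ)).sub (continuousOn_const.mul h3)
  refine h.congr fun q _ ↦ ?_
  exact KerrSchild.bulkForm_eq _ _ q.1 q.2

/-! ## Part 2. The horizon form is positive definite -/

/-- **If the angular square of `q` vanishes, the spatial part of `q` is `(ℓ⃗·q⃗) ℓ⃗`** (at a point
with `r > 0`, where `|ℓ⃗| = 1`): `|q⃗ − (ℓ⃗·q⃗)ℓ⃗|² = |q⃗|² − (ℓ⃗·q⃗)² = |q̸|²`. [folklore] -/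
theorem spatial_eq_of_frameAngSq_eq_zero (hx : 0 < radius a x) {q : Fin 4 → ℝ}
    (hq : frameAngSq a x q = 0) :
    q 1 = spatialDotNull a x q * nullCovectorFun a x 1 ∧
      q 2 = spatialDotNull a x q * nullCovectorFun a x 2 ∧
      q 3 = spatialDotNull a x q * nullCovectorFun a x 3 := by
  have hl := sum_sq_nullCovectorFun hx
  have hs := spatialDotNull_eq a x q
  rw [frameAngSq, Fin.sum_univ_three] at hq
  simp only [Fin.succ_zero_eq_one, Fin.succ_one_eq_two] at hq
  rw [show ((2 : Fin 3).succ : Fin 4) = 3 from rfl] at hq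
  set l₁ := nullCovectorFun a x 1
  set l₂ := nullCovectorFun a x 2
  set l₃ := nullCovectorFun a x 3
  set s := spatialDotNull a x q
  have hid : (q 1 - s * l₁) ^ 2 + (q 2 - s * l₂) ^ 2 + (q 3 - s * l₃) ^ 2 = 0 := by
    have e : (q 1 - s * l₁) ^ 2 + (q 2 - s * l₂) ^ 2 + (q 3 - s * l₃) ^ 2 =
        (q 1 ^ 2 + q 2 ^ 2 + q 3 ^ 2) - 2 * s * (l₁ * q 1 + l₂ * q 2 + l₃ * q 3) +
          s ^ 2 * (l₁ ^ 2 + l₂ ^ 2 + l₃ ^ 2) := by ring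
    rw [e, hl, ← hs]
    nlinarith [hq]
  have h1 : (q 1 - s * l₁) ^ 2 = 0 := by
    nlinarith [sq_nonneg (q 1 - s * l₁), sq_nonneg (q 2 - s * l₂), sq_nonneg (q 3 - s * l₃)]
  have h2 : (q 2 - s * l₂) ^ 2 = 0 := by
    nlinarith [sq_nonneg (q 1 - s * l₁), sq_nonneg (q 2 - s * l₂), sq_nonneg (q 3 - s * l₃)]
  have h3 : (q 3 - s * l₃) ^ 2 = 0 := by
    nlinarith [sq_nonneg (q 1 - s * l₁), sq_nonneg (q 2 - s * l₂), sq_nonneg (q 3 - s * l₃)]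
  refine ⟨?_, ?_, ?_⟩
  · linarith [sq_eq_zero_iff.mp h1]
  · nlinarith [sq_eq_zero_iff.mp h2]
  · nlinarith [sq_eq_zero_iff.mp h3]

/-- **On the horizon `ℓ(K) = 1/(2H)`**, i.e. `2H · (∑_μ K^μ ℓ_μ) = 1`: contract `dr♯ = 2HK`
(`Kerr.raisedDotRadius_of_radius_eq_rPlus`) with the null covector `ℓ`, whose raised version is
`ℓ♯` with `ℓ♯(r) = 1` (`Kerr.sum_nullVector_mul_dRadius`). In particular the transversal null
vector `ℓ♯` is not tangent to `𝓗⁺`. [cite: DafermosRodnianskiShlapentokhrothman2014, §2.2.2] -/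
theorem two_mul_scalarH_mul_hawkingComp_nullCovectorFun (hMa : |a| ≤ M) (hM : 0 < M)
    (hr : radius a x = rPlus M a) :
    2 * scalarH M a x * hawkingComp M a x (nullCovectorFun a x) = 1 := by
  have hx : 0 < radius a x := hr ▸ rPlus_pos hM a
  rw [← raisedDotRadius_of_radius_eq_rPlus hMa hM hr]
  unfold raisedDotRadius
  have h : ∀ μ, ∑ ν, inverseMetric M a x μ ν * nullCovectorFun a x ν = nullVector a x μ := by
    intro μ
    rw [← sum_inverseMetric_mul_nullCovectorFun M a hx μ]
    exact Finset.sum_congr rfl fun ν _ ↦ by rw [inverseMetric_symm]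
  simp only [h]
  exact sum_nullVector_mul_dRadius hx

/-- **The horizon form is positive definite** (Dafermos–Rodnianski arXiv:0811.0354, proof of
Thm. 7.1: on `𝓗⁺`, `K^N` controls all derivatives). At a point of `{r = r₊}` of a sub-extremal Kerr
chart, with `(r₊ − M)h₁ ≥ 16`, `(r₊ − M)f₁ ≥ 16`, the bulk form of `N` is `> 0` on every non-zero
covector: by `Kerr.redShift_horizon_coercive` it dominates `½h₁λ² + ¼f₁|q̸|² + ((r₊ − M)/(2Σ))v²`,
and `λ = v = 0`, `q̸ = 0` force `p = (ℓ⃗·p⃗) ℓ` (`spatial_eq_of_frameAngSq_eq_zero`, `v = p₀ − ℓ⃗·p⃗`)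
and then `λ = (ℓ⃗·p⃗) ℓ(K) = (ℓ⃗·p⃗)/(2H) = 0`. [cite: DafermosRodnianski2008, Thm. 7.1] -/
theorem bulkForm_redShiftVector_pos_of_radius_eq_rPlus (hMa : IsSubextremal M a)
    (hr : radius a x = rPlus M a) {h₁ f₁ : ℝ} (hh : 16 ≤ (rPlus M a - M) * h₁)
    (hf : 16 ≤ (rPlus M a - M) * f₁) {p : Fin 4 → ℝ} (hp : p ≠ 0) :
    0 < KerrSchild.bulkForm (inverseMetric M a) (redShiftVector M a h₁ f₁) x p := by
  have hM : 0 < M := hMa.pos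
  have hMa' : |a| ≤ M := le_of_lt hMa
  have hx : 0 < radius a x := hr ▸ rPlus_pos hM a
  have hS := blSigma_spatial_pos hx
  have hδ : 0 < rPlus M a - M := by
    rw [rPlus_sub_self]
    refine Real.sqrt_pos.2 (sub_pos.2 ?_)
    have ha : |a| < M := hMa
    have := sq_lt_sq' (abs_lt.1 ha).1 (abs_lt.1 ha).2
    simpa using this
  have hh0 : 0 < h₁ := pos_of_mul_pos_right (by linarith) hδ.le
  have hf0 : 0 < f₁ := pos_of_mul_pos_right (by linarith) hδ.le
  -- the horizon coercivity, for the linear function with differential `p`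
  have key := redShift_horizon_coercive hMa hr hh hf (E4.covector p)
  have hfd : (fun μ ↦ fderiv ℝ (E4.covector p) x (E4.basisVector μ)) = p :=
    funext fun μ ↦ KerrSchild.fderiv_covector_apply p x μ
  rw [hfd] at key
  have key' : h₁ / 2 * hawkingComp M a x p ^ 2 +
      f₁ / 4 * frameAngSq a x (p + frameIn a x p • dRadius a x) +
      (rPlus M a - M) / (2 * blSigma a (E4.spatial x)) * frameIn a x p ^ 2 ≤
      KerrSchild.bulkForm (inverseMetric M a) (redShiftVector M a h₁ f₁) x p := key
  have hA0 : 0 ≤ frameAngSq a x (p + frameIn a x p • dRadius a x) := frameAngSq_nonneg hx _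
  by_contra hneg
  push Not at hneg
  have t1 : 0 ≤ h₁ / 2 * hawkingComp M a x p ^ 2 := by positivity
  have t2 : 0 ≤ f₁ / 4 * frameAngSq a x (p + frameIn a x p • dRadius a x) := by positivity
  have t3 : 0 ≤ (rPlus M a - M) / (2 * blSigma a (E4.spatial x)) * frameIn a x p ^ 2 := by
    positivity
  have e1 : h₁ / 2 * hawkingComp M a x p ^ 2 = 0 := by linarith
  have e2 : f₁ / 4 * frameAngSq a x (p + frameIn a x p • dRadius a x) = 0 := by linarith
  have e3 : (rPlus M a - M) / (2 * blSigma a (E4.spatial x)) * frameIn a x p ^ 2 = 0 := by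
    linarith
  have hlam : hawkingComp M a x p = 0 := by
    rcases mul_eq_zero.mp e1 with h | h
    · exact absurd h (by positivity)
    · exact pow_eq_zero_iff two_ne_zero |>.mp h
  have hv : frameIn a x p = 0 := by
    rcases mul_eq_zero.mp e3 with h | h
    · exact absurd h (by positivity)
    · exact pow_eq_zero_iff two_ne_zero |>.mp h
  have hAz : frameAngSq a x p = 0 := by
    rcases mul_eq_zero.mp e2 with h | h
    · exact absurd h (by positivity)
    · simpa [hv] using h
  obtain ⟨q1, q2, q3⟩ := spatial_eq_of_frameAngSq_eq_zero hx hAz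
  set s := spatialDotNull a x p with hs_def
  have q0 : p 0 = s * nullCovectorFun a x 0 := by
    rw [nullCovectorFun_apply_zero, mul_one]
    have := frameIn_eq a x p
    linarith
  have hpl : ∀ μ, p μ = s * nullCovectorFun a x μ := by
    intro μ
    fin_cases μ
    · exact q0
    · exact q1
    · exact q2
    · exact q3
  -- `λ(p) = s λ(ℓ)` and `2H λ(ℓ) = 1`
  have hlin : hawkingComp M a x p = s * hawkingComp M a x (nullCovectorFun a x) := by
    simp only [hawkingComp]
    rw [Finset.mul_sum]
    exact Finset.sum_congr rfl fun μ _ ↦ by rw [hpl μ]; ring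
  have hℓ := two_mul_scalarH_mul_hawkingComp_nullCovectorFun hMa' hM hr
  have hs0 : s = 0 := by
    have h2 : s * (2 * scalarH M a x * hawkingComp M a x (nullCovectorFun a x)) = 0 := by
      rw [hlin] at hlam
      linear_combination (2 * scalarH M a x) * hlam
    rw [hℓ, mul_one] at h2
    exact h2
  exact hp (funext fun μ ↦ by rw [hpl μ, hs0, zero_mul]; rfl)


/-! ## Part 3. Compactness: the horizon slab at `t* = 0` and the unit sphere of covectors -/

/-- `‖x⃗‖² ≤ r² + a²` wherever `r > 0` (from the quartic: `(ρ² − a²) r² = r⁴ − a²z² ≤ r⁴`).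
[cite: arXiv07060622, (35)] -/
theorem spatialNorm_sq_le (hx : 0 < radius a x) :
    E4.spatialNorm x ^ 2 ≤ radius a x ^ 2 + a ^ 2 := by
  have hq := radius_quartic a x
  have hr2 : 0 < radius a x ^ 2 := by positivity
  nlinarith [hq, hr2, sq_nonneg (a * x 3)]

/-- The pole point `c ∂₃` (`c ≥ 0`) has Kerr–Schild radius `c` (`ρ² = z² = c²`, the discriminant
is `(c² + a²)²`). [cite: arXiv07060622, (35)] -/
theorem radius_smul_basisVector_three (a : ℝ) {c : ℝ} (hc : 0 ≤ c) :
    radius a (c • E4.basisVector 3) = c := by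
  have h1 : (c • E4.basisVector 3 : E4) 1 = 0 := by simp [E4.basisVector]
  have h2 : (c • E4.basisVector 3 : E4) 2 = 0 := by simp [E4.basisVector]
  have h3 : (c • E4.basisVector 3 : E4) 3 = c := by simp [E4.basisVector]
  have hρ : E4.spatialNorm (c • E4.basisVector 3) ^ 2 = c ^ 2 := by
    rw [E4.spatialNorm_sq, h1, h2, h3]; ring
  unfold radius
  rw [hρ, h3, show (c ^ 2 - a ^ 2) ^ 2 + 4 * a ^ 2 * c ^ 2 = (c ^ 2 + a ^ 2) ^ 2 by ring,
    Real.sqrt_sq (by positivity), show (c ^ 2 - a ^ 2 + (c ^ 2 + a ^ 2)) / 2 = c ^ 2 by ring,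
    Real.sqrt_sq hc]

/-- **The horizon slab at `t* = 0` is compact**: `{x⁰ = 0, |r − r₊| ≤ η₀}` is closed (continuity of
`r`) and bounded (`‖x⃗‖² ≤ r² + a²`). [folklore] -/
theorem isCompact_timeZero_radius_slab (a : ℝ) {r₁ η₀ : ℝ} (hη : η₀ < r₁) :
    IsCompact {x : E4 | x 0 = 0 ∧ |radius a x - r₁| ≤ η₀} := by
  refine Metric.isCompact_of_isClosed_isBounded ?_ ?_
  · rw [Set.setOf_and]
    refine IsClosed.inter ?_ ?_
    · have hc : Continuous fun x : E4 ↦ x 0 := (E4.dx 0).continuous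
      exact isClosed_eq hc continuous_const
    · exact isClosed_le (((continuous_radius a).sub continuous_const).abs) continuous_const
  · rw [isBounded_iff_forall_norm_le]
    refine ⟨√((r₁ + η₀) ^ 2 + a ^ 2), fun x hx ↦ ?_⟩
    obtain ⟨hx0, hxr⟩ := hx
    have hr : 0 < radius a x := by
      have := (abs_le.mp hxr).1
      linarith
    have hle : radius a x ≤ r₁ + η₀ := by
      have := (abs_le.mp hxr).2
      linarith
    have hsq : ‖x‖ ^ 2 ≤ (r₁ + η₀) ^ 2 + a ^ 2 := by
      -- `‖x‖² = (x⁰)² + ‖x⃗‖²`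
      rw [EuclideanSpace.real_norm_sq_eq, Fin.sum_univ_four, hx0]
      have h1 := spatialNorm_sq_le hr
      rw [E4.spatialNorm_sq] at h1
      have h2 : radius a x ^ 2 ≤ (r₁ + η₀) ^ 2 := pow_le_pow_left₀ hr.le hle 2
      linarith
    calc ‖x‖ = √(‖x‖ ^ 2) := (Real.sqrt_sq (norm_nonneg x)).symm
      _ ≤ √((r₁ + η₀) ^ 2 + a ^ 2) := Real.sqrt_le_sqrt hsq

/-- `∑_μ p_μ² ≤ 4 ‖p‖²` for the sup norm of `p : Fin 4 → ℝ`. [folklore] -/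
theorem sum_sq_le_four_mul_norm_sq (p : Fin 4 → ℝ) : ∑ μ, p μ ^ 2 ≤ 4 * ‖p‖ ^ 2 := by
  have h : ∀ μ, p μ ^ 2 ≤ ‖p‖ ^ 2 := fun μ ↦ by
    have h1 : ‖p μ‖ ≤ ‖p‖ := norm_le_pi_norm p μ
    rw [Real.norm_eq_abs] at h1
    exact sq_le_sq' (abs_le.mp h1).1 (abs_le.mp h1).2
  calc ∑ μ, p μ ^ 2 ≤ ∑ _μ : Fin 4, ‖p‖ ^ 2 := Finset.sum_le_sum fun μ _ ↦ h μ
    _ = 4 * ‖p‖ ^ 2 := by simp [Finset.sum_const, Finset.card_univ, Fintype.card_fin]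

/-- `‖p‖² ≤ ∑_μ p_μ²` for the sup norm of `p : Fin 4 → ℝ`. [folklore] -/
theorem norm_sq_le_sum_sq (p : Fin 4 → ℝ) : ‖p‖ ^ 2 ≤ ∑ μ, p μ ^ 2 := by
  have h0 : 0 ≤ ∑ μ, p μ ^ 2 := Finset.sum_nonneg fun μ _ ↦ sq_nonneg _
  have h : ‖p‖ ≤ √(∑ μ, p μ ^ 2) := by
    refine (pi_norm_le_iff_of_nonneg (Real.sqrt_nonneg _)).mpr fun μ ↦ ?_
    rw [Real.norm_eq_abs]
    refine Real.abs_le_sqrt ?_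
    exact Finset.single_le_sum (f := fun μ ↦ p μ ^ 2) (fun _ _ ↦ sq_nonneg _) (Finset.mem_univ μ)
  calc ‖p‖ ^ 2 ≤ (√(∑ μ, p μ ^ 2)) ^ 2 := pow_le_pow_left₀ (norm_nonneg _) h 2
    _ = ∑ μ, p μ ^ 2 := Real.sq_sqrt h0

/-! ## Part 4. The red-shift on a collar of the horizon (Prop. 4.5.1, first bullet) -/

/-- **The red-shift multiplier is strictly coercive on a collar of the horizon**
(Dafermos–Rodnianski–Shlapentokh-Rothman, arXiv:1402.7034, Prop. 4.5.1, first bullet, for the explicit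
`N = (1 + h₁(r − r₊))K + (1 + f₁(r − r₊))k` of `KerrRedShiftBulk.lean`; Dafermos–Rodnianski
arXiv:0811.0354, Thm. 7.1 and §3.3.2, "by continuity"). Let `|a| < M` and let the parameters satisfy
`(r₊ − M)h₁ ≥ 16`, `(r₊ − M)f₁ ≥ 16`. Then there are `η > 0` and `b > 0` such that at every point `x`
of the two-sided collar `|r(x) − r₊| ≤ η` and for every `ψ : E4 → ℝ`,
`b ∑_μ (∂_μψ(x))² ≤ K^N[ψ](x)`.
Proof: `K^N[ψ](x) = K^N(x)(dψ(x))` is a quadratic form in `dψ(x)` with coefficients continuous in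
`x` and invariant under `t*`-translations; on the compact set `{x⁰ = 0, r = r₊} × {‖p‖ = 1}` it is
positive (`bulkForm_redShiftVector_pos_of_radius_eq_rPlus`), hence `≥ m > 0`; the closed subset of
the compact `{x⁰ = 0, |r − r₊| ≤ r₊/2} × {‖p‖ = 1}` where it is `≤ m/2` stays at positive
`r`-distance from the horizon, which gives `η`; translation invariance removes `x⁰ = 0` and
homogeneity removes `‖p‖ = 1`. [cite: DafermosRodnianskiShlapentokhrothman2014, Prop. 4.5.1] -/
theorem exists_redShift_bulk_coercive (hMa : IsSubextremal M a) {h₁ f₁ : ℝ}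
    (hh : 16 ≤ (rPlus M a - M) * h₁) (hf : 16 ≤ (rPlus M a - M) * f₁) :
    ∃ η : ℝ, 0 < η ∧ ∃ b : ℝ, 0 < b ∧ ∀ x : E4, |radius a x - rPlus M a| ≤ η →
      ∀ w : E4 → ℝ, b * ∑ μ, fderiv ℝ w x (E4.basisVector μ) ^ 2 ≤
        KerrSchild.multiplierBulk (inverseMetric M a) (redShiftVector M a h₁ f₁) w x := by
  have hM : 0 < M := hMa.pos
  have hrp : 0 < rPlus M a := rPlus_pos hM a
  set G := inverseMetric M a with hG
  set X := redShiftVector M a h₁ f₁ with hX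
  set Φ : E4 × (Fin 4 → ℝ) → ℝ := fun q ↦ KerrSchild.bulkForm G X q.1 q.2 with hΦ
  have hΦc : ContinuousOn Φ {q | 0 < radius a q.1} := continuousOn_bulkForm_redShiftVector M a h₁ f₁
  -- the compact sets
  set K₁ : Set E4 := {x | x 0 = 0 ∧ |radius a x - rPlus M a| ≤ rPlus M a / 2} with hK₁
  set K₀ : Set E4 := {x | x 0 = 0 ∧ radius a x = rPlus M a} with hK₀
  set S : Set (Fin 4 → ℝ) := sphere 0 1 with hS
  have hK₁c : IsCompact K₁ := isCompact_timeZero_radius_slab a (by linarith)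
  have hK₀₁ : K₀ ⊆ K₁ := fun x hx ↦ ⟨hx.1, by rw [hx.2, sub_self, abs_zero]; positivity⟩
  have hK₀c : IsCompact K₀ := by
    refine hK₁c.of_isClosed_subset ?_ hK₀₁
    rw [hK₀, Set.setOf_and]
    refine IsClosed.inter ?_ (isClosed_eq (continuous_radius a) continuous_const)
    have hc : Continuous fun x : E4 ↦ x 0 := (E4.dx 0).continuous
    exact isClosed_eq hc continuous_const
  have hSc : IsCompact S := isCompact_sphere _ _
  have hpos₁ : ∀ x ∈ K₁, 0 < radius a x := fun x hx ↦ by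
    have := (abs_le.mp hx.2).1
    linarith
  have hU₁ : K₁ ×ˢ S ⊆ {q : E4 × (Fin 4 → ℝ) | 0 < radius a q.1} := fun q hq ↦ hpos₁ q.1 hq.1
  have hΦ₁ : ContinuousOn Φ (K₁ ×ˢ S) := hΦc.mono hU₁
  have hSne : ∀ p ∈ S, p ≠ 0 := fun p hp h0 ↦ by
    rw [hS, mem_sphere_zero_iff_norm, h0, norm_zero] at hp
    exact zero_ne_one hp
  -- Step 1: a positive minimum on `K₀ × S`
  have hne₀ : (K₀ ×ˢ S).Nonempty := by
    refine ⟨(rPlus M a • E4.basisVector 3, fun _ ↦ (1 : ℝ)), ⟨?_, ?_⟩, ?_⟩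
    · simp [E4.basisVector]
    · exact radius_smul_basisVector_three a hrp.le
    · rw [hS, mem_sphere_zero_iff_norm, pi_norm_const, norm_one]
  obtain ⟨q₀, hq₀, hmin⟩ :=
    (hK₀c.prod hSc).exists_isMinOn hne₀ (hΦ₁.mono (Set.prod_mono hK₀₁ subset_rfl))
  set m := Φ q₀ with hm_def
  have hm : 0 < m :=
    bulkForm_redShiftVector_pos_of_radius_eq_rPlus hMa hq₀.1.2 hh hf (hSne q₀.2 hq₀.2)
  have hmin' : ∀ q ∈ K₀ ×ˢ S, m ≤ Φ q := fun q hq ↦ (isMinOn_iff.mp hmin) q hq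
  -- Step 2: the set where the form is small stays away from the horizon
  set b := m / 2 with hb_def
  have hb : 0 < b := by positivity
  set C : Set (E4 × (Fin 4 → ℝ)) := (K₁ ×ˢ S) ∩ Φ ⁻¹' Iic b with hC
  have hCclosed : IsClosed C :=
    hΦ₁.preimage_isClosed_of_isClosed (hK₁c.prod hSc).isClosed isClosed_Iic
  have hCc : IsCompact C := (hK₁c.prod hSc).of_isClosed_subset hCclosed inter_subset_left
  have hCr : ∀ q ∈ C, radius a q.1 ≠ rPlus M a := by
    intro q hq heq
    have h1 : m ≤ Φ q := hmin' q ⟨⟨hq.1.1.1, heq⟩, hq.1.2⟩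
    have h2 : Φ q ≤ b := hq.2
    linarith
  have hη : ∃ η : ℝ, 0 < η ∧ η ≤ rPlus M a / 2 ∧ ∀ q ∈ C, η < |radius a q.1 - rPlus M a| := by
    rcases C.eq_empty_or_nonempty with hCe | hCne
    · exact ⟨rPlus M a / 2, by positivity, le_rfl, fun q hq ↦ by simp [hCe] at hq⟩
    · have hg : Continuous fun q : E4 × (Fin 4 → ℝ) ↦ |radius a q.1 - rPlus M a| :=
        (((continuous_radius a).comp continuous_fst).sub continuous_const).abs
      obtain ⟨q₁, hq₁, hmin₁⟩ := hCc.exists_isMinOn hCne hg.continuousOn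
      have hδ₀ : 0 < |radius a q₁.1 - rPlus M a| := abs_pos.mpr (sub_ne_zero.mpr (hCr q₁ hq₁))
      refine ⟨min (|radius a q₁.1 - rPlus M a| / 2) (rPlus M a / 2), lt_min (by positivity)
        (by positivity), min_le_right _ _, fun q hq ↦ ?_⟩
      have := (isMinOn_iff.mp hmin₁) q hq
      have h2 := min_le_left (|radius a q₁.1 - rPlus M a| / 2) (rPlus M a / 2)
      linarith
  obtain ⟨η, hη0, hηle, hηC⟩ := hη
  -- Step 3: on the slab `x⁰ = 0`, `|r − r₊| ≤ η`, the form is `≥ b` on unit covectors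
  have hslab : ∀ x : E4, x 0 = 0 → |radius a x - rPlus M a| ≤ η → ∀ p ∈ S, b ≤ Φ (x, p) := by
    intro x hx0 hxr p hpS
    by_contra hlt
    push Not at hlt
    have hq : (x, p) ∈ C := ⟨⟨⟨hx0, hxr.trans hηle⟩, hpS⟩, hlt.le⟩
    have := hηC _ hq
    exact absurd hxr (not_le.mpr this)
  -- Step 4: remove `x⁰ = 0` by stationarity and `‖p‖ = 1` by homogeneity
  refine ⟨η, hη0, b / 4, by positivity, fun x hxr w ↦ ?_⟩
  set p : Fin 4 → ℝ := fun μ ↦ fderiv ℝ w x (E4.basisVector μ) with hp_def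
  rw [KerrSchild.multiplierBulk_eq_bulkForm]
  show b / 4 * ∑ μ, p μ ^ 2 ≤ KerrSchild.bulkForm G X x p
  set x₀ : E4 := x + (-(x 0)) • E4.basisVector 0 with hx₀_def
  have hx₀0 : x₀ 0 = 0 := by simp [hx₀_def, E4.basisVector]
  have hx₀r : radius a x₀ = radius a x := radius_add_time_smul_basisVector a x _
  have hΦx : KerrSchild.bulkForm G X x p = KerrSchild.bulkForm G X x₀ p :=
    (bulkForm_redShiftVector_add_smul_basisVector_zero M a h₁ f₁ x (-(x 0)) p).symm
  rw [hΦx]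
  by_cases hp0 : p = 0
  · rw [hp0, KerrSchild.bulkForm_zero]
    simp
  · set c := ‖p‖ with hc_def
    have hc : 0 < c := norm_pos_iff.mpr hp0
    have hu : c⁻¹ • p ∈ S := by
      rw [hS, mem_sphere_zero_iff_norm, norm_smul, norm_inv, norm_norm, inv_mul_cancel₀ hc.ne']
    have h1 : b ≤ Φ (x₀, c⁻¹ • p) := hslab x₀ hx₀0 (hx₀r ▸ hxr) _ hu
    have h2 : KerrSchild.bulkForm G X x₀ p = c ^ 2 * KerrSchild.bulkForm G X x₀ (c⁻¹ • p) := by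
      have := KerrSchild.bulkForm_smul G X x₀ c (c⁻¹ • p)
      rw [smul_smul, mul_inv_cancel₀ hc.ne', one_smul] at this
      exact this
    have h3 : ∑ μ, p μ ^ 2 ≤ 4 * c ^ 2 := sum_sq_le_four_mul_norm_sq p
    rw [h2]
    change b / 4 * ∑ μ, p μ ^ 2 ≤ c ^ 2 * Φ (x₀, c⁻¹ • p)
    have hc2 : 0 ≤ c ^ 2 := sq_nonneg _
    nlinarith [h1, h3, mul_le_mul_of_nonneg_left h1 hc2]

/-- **Prop. 4.5.1, first bullet, as printed (one-sided collar `r₊ ≤ r ≤ r_red`)**: for `|a| < M` and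
parameters with `(r₊ − M)h₁, (r₊ − M)f₁ ≥ 16` there are `r_red > r₊` and `b > 0` with
`b ∑_μ (∂_μψ)² ≤ K^N[ψ]` on `{r₊ ≤ r ≤ r_red}`. [cite: DafermosRodnianskiShlapentokhrothman2014, Prop. 4.5.1] -/
theorem exists_redShift_bulk_coercive_exterior (hMa : IsSubextremal M a) {h₁ f₁ : ℝ}
    (hh : 16 ≤ (rPlus M a - M) * h₁) (hf : 16 ≤ (rPlus M a - M) * f₁) :
    ∃ rred : ℝ, rPlus M a < rred ∧ ∃ b : ℝ, 0 < b ∧ ∀ x : E4, rPlus M a ≤ radius a x →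
      radius a x ≤ rred → ∀ w : E4 → ℝ, b * ∑ μ, fderiv ℝ w x (E4.basisVector μ) ^ 2 ≤
        KerrSchild.multiplierBulk (inverseMetric M a) (redShiftVector M a h₁ f₁) w x := by
  obtain ⟨η, hη, b, hb, h⟩ := exists_redShift_bulk_coercive hMa hh hf
  refine ⟨rPlus M a + η, by linarith, b, hb, fun x h1 h2 w ↦ h x ?_ w⟩
  rw [abs_le]
  constructor <;> linarith

/-! ## Part 5. The bulk of `N` is bounded on compact `r`-ranges (Prop. 4.5.1, second bullet) -/

/-- **`|K^N| ≤ B ∑_μ (∂_μψ)²` on `{r₀ ≤ r ≤ R}`** (`0 < r₀`, any `R` and any parameters `h₁, f₁`): the form in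
which the second bullet `−K^N ≤ B J^N_μ N^μ` (`r ≥ r_red`) of DRSR Prop. 4.5.1 is used on bounded
`r`-ranges — the coefficients of the quadratic form `K^N(x)` are continuous in `x` and
`t*`-independent, hence bounded on `{x⁰ = 0, r₀ ≤ r ≤ R} × {‖p‖ = 1}`.
[cite: DafermosRodnianskiShlapentokhrothman2014, Prop. 4.5.1] -/
theorem exists_abs_bulk_redShiftVector_le (M a h₁ f₁ : ℝ) {r₀ R : ℝ} (hr₀ : 0 < r₀) :
    ∃ B : ℝ, ∀ x : E4, r₀ ≤ radius a x → radius a x ≤ R → ∀ w : E4 → ℝ,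
      |KerrSchild.multiplierBulk (inverseMetric M a) (redShiftVector M a h₁ f₁) w x| ≤
        B * ∑ μ, fderiv ℝ w x (E4.basisVector μ) ^ 2 := by
  set G := inverseMetric M a with hG
  set X := redShiftVector M a h₁ f₁ with hX
  set Φ : E4 × (Fin 4 → ℝ) → ℝ := fun q ↦ KerrSchild.bulkForm G X q.1 q.2 with hΦ
  have hΦc : ContinuousOn Φ {q | 0 < radius a q.1} := continuousOn_bulkForm_redShiftVector M a h₁ f₁
  -- `{x⁰ = 0, r₀ ≤ r ≤ R} = {x⁰ = 0, |r − (r₀+R)/2| ≤ (R−r₀)/2}`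
  set K : Set E4 := {x | x 0 = 0 ∧ |radius a x - (r₀ + R) / 2| ≤ (R - r₀) / 2} with hK
  set S : Set (Fin 4 → ℝ) := sphere 0 1 with hS
  have hKc : IsCompact K := isCompact_timeZero_radius_slab a (by linarith)
  have hSc : IsCompact S := isCompact_sphere _ _
  have hmemK : ∀ x : E4, x 0 = 0 → r₀ ≤ radius a x → radius a x ≤ R → x ∈ K := by
    intro x h0 h1 h2
    refine ⟨h0, abs_le.mpr ⟨by linarith, by linarith⟩⟩
  have hpos : ∀ x ∈ K, 0 < radius a x := fun x hx ↦ by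
    have := (abs_le.mp hx.2).1
    linarith
  have hΦK : ContinuousOn Φ (K ×ˢ S) := hΦc.mono fun q hq ↦ hpos q.1 hq.1
  obtain ⟨B, hB⟩ := (hKc.prod hSc).exists_bound_of_continuousOn hΦK
  refine ⟨max B 0, fun x h1 h2 w ↦ ?_⟩
  set p : Fin 4 → ℝ := fun μ ↦ fderiv ℝ w x (E4.basisVector μ) with hp_def
  rw [KerrSchild.multiplierBulk_eq_bulkForm]
  show |KerrSchild.bulkForm G X x p| ≤ max B 0 * ∑ μ, p μ ^ 2
  set x₀ : E4 := x + (-(x 0)) • E4.basisVector 0 with hx₀_def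
  have hx₀0 : x₀ 0 = 0 := by simp [hx₀_def, E4.basisVector]
  have hx₀r : radius a x₀ = radius a x := radius_add_time_smul_basisVector a x _
  have hΦx : KerrSchild.bulkForm G X x p = KerrSchild.bulkForm G X x₀ p :=
    (bulkForm_redShiftVector_add_smul_basisVector_zero M a h₁ f₁ x (-(x 0)) p).symm
  rw [hΦx]
  have hxK : x₀ ∈ K := hmemK x₀ hx₀0 (hx₀r ▸ h1) (hx₀r ▸ h2)
  by_cases hp0 : p = 0
  · rw [hp0, KerrSchild.bulkForm_zero]
    simp
  · set c := ‖p‖ with hc_def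
    have hc : 0 < c := norm_pos_iff.mpr hp0
    have hu : c⁻¹ • p ∈ S := by
      rw [hS, mem_sphere_zero_iff_norm, norm_smul, norm_inv, norm_norm, inv_mul_cancel₀ hc.ne']
    have hq : |Φ (x₀, c⁻¹ • p)| ≤ B := by
      have := hB (x₀, c⁻¹ • p) ⟨hxK, hu⟩
      rwa [Real.norm_eq_abs] at this
    have h2 : KerrSchild.bulkForm G X x₀ p = c ^ 2 * KerrSchild.bulkForm G X x₀ (c⁻¹ • p) := by
      have := KerrSchild.bulkForm_smul G X x₀ c (c⁻¹ • p)
      rw [smul_smul, mul_inv_cancel₀ hc.ne', one_smul] at this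
      exact this
    have h3 : c ^ 2 ≤ ∑ μ, p μ ^ 2 := norm_sq_le_sum_sq p
    rw [h2]
    change |c ^ 2 * Φ (x₀, c⁻¹ • p)| ≤ max B 0 * ∑ μ, p μ ^ 2
    rw [abs_mul, abs_of_nonneg (sq_nonneg c)]
    calc c ^ 2 * |Φ (x₀, c⁻¹ • p)| ≤ c ^ 2 * max B 0 :=
          mul_le_mul_of_nonneg_left (hq.trans (le_max_left _ _)) (sq_nonneg c)
      _ = max B 0 * c ^ 2 := by ring
      _ ≤ max B 0 * ∑ μ, p μ ^ 2 := mul_le_mul_of_nonneg_left h3 (le_max_right _ _)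


end Kerr

end Literature.Geometry.Lorentzian
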